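import Summits.NavierStokesRegularity.NavierStokesRegularity.Theorems.ExtremiserTransiencePerFlowLockedTimesLogDensityPrelims
import HarnessLib

/-!
# Route `ExtremiserTransience`, LINE g4-α «per-flow-tangent» (ns-idea-5 g4): PIECE SELECTION for `stub_extraction_of_lock`

`--supports stmt-NavierStokesRegularity-26568` (`TangentExtremalExtraction`).  The sup-normalised stretching efficiency
`R = J/(M√Z√P)` is invariant under replication by far-apart copies (BC-RECORD 09:35Z), so near-extremal efficiency forces ONE SCALE
but not ONE BALL; the extraction step of skeleton v3d must therefore SELECT A PIECE.  This file lands the abstract selection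
inequalities (finitely many pieces with additive `Z, P, J`):

* `exists_efficient_piece` (Cauchy–Schwarz): if `J = Σ Jᵢ ≥ R·M·√Z·√P` with `Z = Σ Zᵢ`, `P = Σ Pᵢ`, then some piece is itself
  `R`-efficient AT THE GLOBAL AMPLITUDE: `Jᵢ ≥ R·M·√Zᵢ·√Pᵢ`;
* `amplitude_of_efficient_piece`: if moreover the universal bound `Jᵢ ≤ κ·Mᵢ·√Zᵢ·√Pᵢ` holds on that piece with its own amplitude
  `Mᵢ` and `√Zᵢ√Pᵢ > 0`, then `Mᵢ ≥ (R/κ)·M` — the selected piece carries a definite fraction of the sup norm;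
* `exists_efficient_heavy_piece`: the two combined, plus `R`-efficiency of the piece at its own amplitude when `Mᵢ ≤ M`.
HONEST FRAMING: elementary real inequalities; nothing about Navier–Stokes regularity or blow-up is proved. [folklore]
-/

noncomputable section

open Finset
open scoped BigOperators

namespace Summit.NavierStokesRegularity.NavierStokesRegularity.Theorems.DepletionLadder.PerFlow
set_option linter.dupNamespace false
set_option linter.style.longLine false

/-- **Piece selection (Cauchy–Schwarz).** [folklore] -/
theorem exists_efficient_piece {ι : Type*} (s : Finset ι) (hs : s.Nonempty) {Zp Pp Jp : ι → ℝ}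
    (hZ : ∀ i, 0 ≤ Zp i) (hP : ∀ i, 0 ≤ Pp i) {R M : ℝ} (hR : 0 ≤ R) (hM : 0 ≤ M)
    (hJ : R * M * Real.sqrt (∑ i ∈ s, Zp i) * Real.sqrt (∑ i ∈ s, Pp i) ≤ ∑ i ∈ s, Jp i) :
    ∃ i ∈ s, R * M * Real.sqrt (Zp i) * Real.sqrt (Pp i) ≤ Jp i := by
  by_contra h
  push Not at h
  have hlt : ∑ i ∈ s, Jp i < ∑ i ∈ s, R * M * Real.sqrt (Zp i) * Real.sqrt (Pp i) :=
    Finset.sum_lt_sum_of_nonempty hs fun i hi => h i hi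
  have hcs := Real.sum_sqrt_mul_sqrt_le s hZ hP
  have hfac : ∑ i ∈ s, R * M * Real.sqrt (Zp i) * Real.sqrt (Pp i) = R * M * ∑ i ∈ s, Real.sqrt (Zp i) * Real.sqrt (Pp i) := by
    rw [Finset.mul_sum]; refine Finset.sum_congr rfl fun i _ => ?_; ring
  have hRM : 0 ≤ R * M := mul_nonneg hR hM
  have := mul_le_mul_of_nonneg_left hcs hRM
  have h' : R * M * (Real.sqrt (∑ i ∈ s, Zp i) * Real.sqrt (∑ i ∈ s, Pp i)) =
      R * M * Real.sqrt (∑ i ∈ s, Zp i) * Real.sqrt (∑ i ∈ s, Pp i) := by ring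
  linarith

/-- **Amplitude of an efficient piece.** [folklore] -/
theorem amplitude_of_efficient_piece {κ R M Mi Zi Pi Ji : ℝ} (hκ : 0 < κ)
    (hpos : 0 < Real.sqrt Zi * Real.sqrt Pi)
    (huniv : Ji ≤ κ * Mi * Real.sqrt Zi * Real.sqrt Pi) (heff : R * M * Real.sqrt Zi * Real.sqrt Pi ≤ Ji) :
    R / κ * M ≤ Mi := by
  have h1 : R * M * (Real.sqrt Zi * Real.sqrt Pi) ≤ κ * Mi * (Real.sqrt Zi * Real.sqrt Pi) := by
    have := heff.trans huniv
    calc R * M * (Real.sqrt Zi * Real.sqrt Pi) = R * M * Real.sqrt Zi * Real.sqrt Pi := by ring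
      _ ≤ κ * Mi * Real.sqrt Zi * Real.sqrt Pi := this
      _ = κ * Mi * (Real.sqrt Zi * Real.sqrt Pi) := by ring
  have h2 : R * M ≤ κ * Mi := le_of_mul_le_mul_right h1 hpos
  rw [div_mul_eq_mul_div, div_le_iff₀ hκ]
  linarith

/-- **Efficiency of a piece at its own amplitude.** If the piece is `R`-efficient at the global amplitude `M ≥ Mᵢ ≥ 0` and `R ≥ 0`,
it is `R`-efficient at its own amplitude. [folklore] -/
theorem efficient_at_own_amplitude {R M Mi Zi Pi Ji : ℝ} (hR : 0 ≤ R) (hMi : Mi ≤ M)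
    (heff : R * M * Real.sqrt Zi * Real.sqrt Pi ≤ Ji) : R * Mi * Real.sqrt Zi * Real.sqrt Pi ≤ Ji := by
  have hzp : 0 ≤ Real.sqrt Zi * Real.sqrt Pi := mul_nonneg (Real.sqrt_nonneg _) (Real.sqrt_nonneg _)
  have : R * Mi * (Real.sqrt Zi * Real.sqrt Pi) ≤ R * M * (Real.sqrt Zi * Real.sqrt Pi) :=
    mul_le_mul_of_nonneg_right (mul_le_mul_of_nonneg_left hMi hR) hzp
  calc R * Mi * Real.sqrt Zi * Real.sqrt Pi = R * Mi * (Real.sqrt Zi * Real.sqrt Pi) := by ring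
    _ ≤ R * M * (Real.sqrt Zi * Real.sqrt Pi) := this
    _ = R * M * Real.sqrt Zi * Real.sqrt Pi := by ring
    _ ≤ Ji := heff

/-- **Selection of an efficient, heavy piece.**  Finitely many pieces with nonnegative `Zᵢ, Pᵢ`, amplitudes `Mᵢ ≤ M`, the
universal bound `Jᵢ ≤ κ Mᵢ √Zᵢ √Pᵢ` on each piece, and global efficiency `Σ Jᵢ ≥ R M √(ΣZᵢ) √(ΣPᵢ) > 0` with `R > 0`, `M > 0`:
some piece is `R`-efficient at the global amplitude (hence at its own), is non-degenerate (`√Zᵢ√Pᵢ > 0`), and has amplitude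
`Mᵢ ≥ (R/κ) M`. [folklore] -/
theorem exists_efficient_heavy_piece {ι : Type*} (s : Finset ι) {Zp Pp Jp Mp : ι → ℝ}
    (hZ : ∀ i, 0 ≤ Zp i) (hP : ∀ i, 0 ≤ Pp i) {κ R M : ℝ} (hκ : 0 < κ) (hR : 0 < R) (hM : 0 < M)
    (hMle : ∀ i ∈ s, Mp i ≤ M)
    (huniv : ∀ i ∈ s, Jp i ≤ κ * Mp i * Real.sqrt (Zp i) * Real.sqrt (Pp i))
    (hglob : 0 < Real.sqrt (∑ i ∈ s, Zp i) * Real.sqrt (∑ i ∈ s, Pp i))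
    (hJ : R * M * Real.sqrt (∑ i ∈ s, Zp i) * Real.sqrt (∑ i ∈ s, Pp i) ≤ ∑ i ∈ s, Jp i) :
    ∃ i ∈ s, R * M * Real.sqrt (Zp i) * Real.sqrt (Pp i) ≤ Jp i ∧
      R * Mp i * Real.sqrt (Zp i) * Real.sqrt (Pp i) ≤ Jp i ∧
      0 < Real.sqrt (Zp i) * Real.sqrt (Pp i) ∧ R / κ * M ≤ Mp i := by
  classical
  -- restrict to the non-degenerate pieces: the degenerate ones contribute `Jᵢ ≤ 0`
  set s' : Finset ι := s.filter fun i => 0 < Real.sqrt (Zp i) * Real.sqrt (Pp i) with hs'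
  have hdeg : ∀ i ∈ s, i ∉ s' → Jp i ≤ 0 := by
    intro i hi hi'
    have h0 : ¬ 0 < Real.sqrt (Zp i) * Real.sqrt (Pp i) := by
      intro h; exact hi' (Finset.mem_filter.2 ⟨hi, h⟩)
    have hzp : Real.sqrt (Zp i) * Real.sqrt (Pp i) = 0 :=
      le_antisymm (not_lt.1 h0) (mul_nonneg (Real.sqrt_nonneg _) (Real.sqrt_nonneg _))
    calc Jp i ≤ κ * Mp i * Real.sqrt (Zp i) * Real.sqrt (Pp i) := huniv i hi
      _ = κ * Mp i * (Real.sqrt (Zp i) * Real.sqrt (Pp i)) := by ring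
      _ = 0 := by rw [hzp, mul_zero]
  -- `Z`, `P` of a degenerate piece: `√Zᵢ √Pᵢ = 0`; the sums over `s'` are at most those over `s`
  have hZle : ∑ i ∈ s', Zp i ≤ ∑ i ∈ s, Zp i := Finset.sum_le_sum_of_subset_of_nonneg (Finset.filter_subset _ _) fun i _ _ => hZ i
  have hPle : ∑ i ∈ s', Pp i ≤ ∑ i ∈ s, Pp i := Finset.sum_le_sum_of_subset_of_nonneg (Finset.filter_subset _ _) fun i _ _ => hP i
  have hJle : ∑ i ∈ s, Jp i ≤ ∑ i ∈ s', Jp i := by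
    rw [← Finset.sum_filter_add_sum_filter_not s (fun i => 0 < Real.sqrt (Zp i) * Real.sqrt (Pp i)) Jp]
    have : ∑ i ∈ s.filter (fun i => ¬ 0 < Real.sqrt (Zp i) * Real.sqrt (Pp i)), Jp i ≤ 0 :=
      Finset.sum_nonpos fun i hi => by
        rw [Finset.mem_filter] at hi
        exact hdeg i hi.1 (fun h => hi.2 (Finset.mem_filter.1 h).2)
    linarith
  -- global efficiency transfers to `s'`
  have hRM : 0 ≤ R * M := (mul_pos hR hM).le
  have hJ' : R * M * Real.sqrt (∑ i ∈ s', Zp i) * Real.sqrt (∑ i ∈ s', Pp i) ≤ ∑ i ∈ s', Jp i := by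
    have h1 : Real.sqrt (∑ i ∈ s', Zp i) * Real.sqrt (∑ i ∈ s', Pp i) ≤
        Real.sqrt (∑ i ∈ s, Zp i) * Real.sqrt (∑ i ∈ s, Pp i) :=
      mul_le_mul (Real.sqrt_le_sqrt hZle) (Real.sqrt_le_sqrt hPle) (Real.sqrt_nonneg _) (Real.sqrt_nonneg _)
    have h2 := mul_le_mul_of_nonneg_left h1 hRM
    calc R * M * Real.sqrt (∑ i ∈ s', Zp i) * Real.sqrt (∑ i ∈ s', Pp i)
        = R * M * (Real.sqrt (∑ i ∈ s', Zp i) * Real.sqrt (∑ i ∈ s', Pp i)) := by ring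
      _ ≤ R * M * (Real.sqrt (∑ i ∈ s, Zp i) * Real.sqrt (∑ i ∈ s, Pp i)) := h2
      _ = R * M * Real.sqrt (∑ i ∈ s, Zp i) * Real.sqrt (∑ i ∈ s, Pp i) := by ring
      _ ≤ ∑ i ∈ s, Jp i := hJ
      _ ≤ ∑ i ∈ s', Jp i := hJle
  -- `s'` is nonempty: otherwise `Σ_s J ≤ 0 < R M √Z √P`
  have hs'ne : s'.Nonempty := by
    by_contra hemp
    rw [Finset.not_nonempty_iff_eq_empty] at hemp
    have h0 : ∑ i ∈ s', Jp i = 0 := by rw [hemp, Finset.sum_empty]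
    have : 0 < R * M * Real.sqrt (∑ i ∈ s, Zp i) * Real.sqrt (∑ i ∈ s, Pp i) := by
      have := mul_pos (mul_pos hR hM) hglob
      calc (0 : ℝ) < R * M * (Real.sqrt (∑ i ∈ s, Zp i) * Real.sqrt (∑ i ∈ s, Pp i)) := this
        _ = _ := by ring
    linarith
  obtain ⟨i, hi', heff⟩ := exists_efficient_piece s' hs'ne hZ hP hR.le hM.le hJ'
  have hi : i ∈ s := (Finset.mem_filter.1 hi').1
  have hposi : 0 < Real.sqrt (Zp i) * Real.sqrt (Pp i) := (Finset.mem_filter.1 hi').2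
  exact ⟨i, hi, heff, efficient_at_own_amplitude hR.le (hMle i hi) heff, hposi,
    amplitude_of_efficient_piece hκ hposi (huniv i hi) heff⟩

end Summit.NavierStokesRegularity.NavierStokesRegularity.Theorems.DepletionLadder.PerFlow

end
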